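import Mathlib
import HarnessLib
import Literature.NumberTheory.LFunctions.VanDerCorputZeta

/-!
# The Weyl-differenced logarithmic phase and its van der Corput dual

Topic `Literature/NumberTheory/LFunctions`. Calculus for the exponent-pair estimate
`∑_{M/2 ≤ m ≤ M} m^{it} ≪ t^{1/9} M^{11/18}` (the pair `(1/9, 13/18) = ABA²B(0,1)` of
Bourgain 2017, eq. (4.2) / Titchmarsh §5.20, for `f(y) = (t/2π) log y`): after one Weyl
differencing with shift `d` the phase is
`φ_d(y) = (t/2π)(log y - log(y + d))`, and van der Corput's `B`-process (Titchmarsh, Thm 4.9)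
turns `∑ e(φ_d(n))` into a sum over the dual variable `ν` of `e(ψ(ν))`,
`ψ(ν) = φ_d(x_ν) - νx_ν`, `φ_d'(x_ν) = ν`. For this phase everything is explicit:
`x_ν = ((d² + 4Kd/ν)^{1/2} - d)/2` (`K = t/2π`), and with `p = 1/y`, `q = 1/(y+d)`:
`φ_d' = K(p - q)`, `φ_d'' = -K(p² - q²)`, `φ_d''' = 2K(p³ - q³)`, `φ_d'''' = -6K(p⁴ - q⁴)`,
`ψ'''' = (φ''''φ'' - 3φ'''²)/φ''⁵ ∘ x_ν = 6P/(K³(p-q)³(p+q)⁵)`, `P = p⁴ + 2p³q + 4p²q² + 2pq³ + q⁴`.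

Everything here is PROVED (no named facts):
* `Literature.NumberTheory.LFunctions.VdC.dphase` — the family `D_j = φ_d^{(j)}` (as differences of
  the tree's `Literature.NumberTheory.LFunctions.VdC.phaseD (-t)`), its closed forms
  (`dphase_one` … `dphase_four`) and derivatives (`hasDerivAt_dphase`);
* size bounds on the box `M/4 ≤ y`, `y + d ≤ 4M` (`neg_dphase_two_bounds`, `dphase_three_bounds`,
  `dual_fourth_bounds`): `Kd/(32M³) ≤ -φ'' ≤ 128Kd/M³`, `0 < φ''' ≤ 1536Kd/M⁴`,
  `(15/2³³) M⁷/(Kd)³ ≤ ψ'''' ≤ (15·2²⁷) M⁷/(Kd)³`;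
* `Literature.NumberTheory.LFunctions.VdC.xsLog` — the stationary point `x_ν`, with
  `xsLog_mul` (`x_ν(x_ν + d) = Kd/ν`), `dphase_one_xsLog` (`φ'(x_ν) = ν`), `hasDerivAt_xsLog`
  (`x_ν' = 1/φ''(x_ν)`), monotonicity and localisation (`xsLog_mem_Icc`);
* `Literature.NumberTheory.LFunctions.VdC.dualFamily` — the family `E_j = ψ^{(j)}`, `j ≤ 4`, of the
  dual phase, a `DerivFamily` (`dualFamily_derivFamily`), and the antitonicity of the
  `B`-process weights `|φ''(x_ν)|^{-1/2}` (`weight_antitone`).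

## References

* E. C. Titchmarsh, *The Theory of the Riemann Zeta-Function*, 2nd ed., §§4.9, 5.20.
* S. W. Graham, G. Kolesnik, *Van der Corput's Method of Exponential Sums*, LMS LN 126 (1991),
  §3.3 (heuristics), Lemma 3.9 (the dual phase), eq. (3.5.3).
-/

noncomputable section

open Real Set Filter Topology

namespace Literature.NumberTheory.LFunctions
namespace VdC

/-! ### The differenced phase family -/

/-- The Weyl-differenced logarithmic phase family:
`dphase t d j y = phaseD (-t) j y - phaseD (-t) j (y + d)`, so that
`dphase t d 0 y = (t/2π)(log y - log(y + d))` and `dphase t d (j+1)` is the derivative of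
`dphase t d j` on `y > 0` (`d ≥ 0`). [folklore] -/
def dphase (t d : ℝ) (j : ℕ) (y : ℝ) : ℝ := phaseD (-t) j y - phaseD (-t) j (y + d)

/-- `phaseD (-t) 0 y = (t/2π) log y`. [folklore] -/
theorem phaseD_negt_zero (t y : ℝ) : phaseD (-t) 0 y = t / (2 * π) * Real.log y := by
  rw [phaseD_zero]; ring

/-- `phaseD (-t) 1 y = (t/2π)/y`. [folklore] -/
theorem phaseD_negt_one (t y : ℝ) : phaseD (-t) 1 y = t / (2 * π) * y⁻¹ := by
  have h : phaseD (-t) 1 y = -t / (2 * π) * (-1) ^ (0 + 1) * (Nat.factorial 0 : ℝ)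
      * y ^ (-((0 : ℤ) + 1)) := phaseD_succ (-t) 0 y
  rw [h]
  simp
  ring

/-- `phaseD (-t) 2 y = -(t/2π)/y²`. [folklore] -/
theorem phaseD_negt_two (t y : ℝ) : phaseD (-t) 2 y = -(t / (2 * π)) * (y ^ 2)⁻¹ := by
  have h : phaseD (-t) 2 y = -t / (2 * π) * (-1) ^ (1 + 1) * (Nat.factorial 1 : ℝ)
      * y ^ (-((1 : ℤ) + 1)) := phaseD_succ (-t) 1 y
  have hz : y ^ (-((1 : ℤ) + 1)) = (y ^ 2)⁻¹ := by
    rw [show (-((1 : ℤ) + 1)) = -((2 : ℕ) : ℤ) by norm_num, zpow_neg, zpow_natCast]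
  rw [h, hz]
  simp
  ring

/-- `phaseD (-t) 3 y = 2(t/2π)/y³`. [folklore] -/
theorem phaseD_negt_three (t y : ℝ) : phaseD (-t) 3 y = 2 * (t / (2 * π)) * (y ^ 3)⁻¹ := by
  have h : phaseD (-t) 3 y = -t / (2 * π) * (-1) ^ (2 + 1) * (Nat.factorial 2 : ℝ)
      * y ^ (-((2 : ℤ) + 1)) := phaseD_succ (-t) 2 y
  have hz : y ^ (-((2 : ℤ) + 1)) = (y ^ 3)⁻¹ := by
    rw [show (-((2 : ℤ) + 1)) = -((3 : ℕ) : ℤ) by norm_num, zpow_neg, zpow_natCast]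
  have h2 : (Nat.factorial 2 : ℝ) = 2 := by norm_num [Nat.factorial]
  rw [h, hz, h2]
  ring

/-- `phaseD (-t) 4 y = -6(t/2π)/y⁴`. [folklore] -/
theorem phaseD_negt_four (t y : ℝ) : phaseD (-t) 4 y = -(6 * (t / (2 * π))) * (y ^ 4)⁻¹ := by
  have h : phaseD (-t) 4 y = -t / (2 * π) * (-1) ^ (3 + 1) * (Nat.factorial 3 : ℝ)
      * y ^ (-((3 : ℤ) + 1)) := phaseD_succ (-t) 3 y
  have hz : y ^ (-((3 : ℤ) + 1)) = (y ^ 4)⁻¹ := by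
    rw [show (-((3 : ℤ) + 1)) = -((4 : ℕ) : ℤ) by norm_num, zpow_neg, zpow_natCast]
  have h6 : (Nat.factorial 3 : ℝ) = 6 := by norm_num [Nat.factorial]
  rw [h, hz, h6]
  ring

/-- `φ_d(y) = (t/2π)(log y - log(y+d))`. [folklore] -/
theorem dphase_zero (t d y : ℝ) :
    dphase t d 0 y = t / (2 * π) * (Real.log y - Real.log (y + d)) := by
  simp only [dphase, phaseD_negt_zero]; ring

/-- `φ_d'(y) = K(1/y - 1/(y+d))`, `K = t/2π`. [folklore] -/
theorem dphase_one (t d y : ℝ) : dphase t d 1 y = t / (2 * π) * (y⁻¹ - (y + d)⁻¹) := by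
  simp only [dphase, phaseD_negt_one]; ring

/-- `φ_d''(y) = -K(1/y² - 1/(y+d)²)`. [folklore] -/
theorem dphase_two (t d y : ℝ) :
    dphase t d 2 y = -(t / (2 * π)) * ((y ^ 2)⁻¹ - ((y + d) ^ 2)⁻¹) := by
  simp only [dphase, phaseD_negt_two]; ring

/-- `φ_d'''(y) = 2K(1/y³ - 1/(y+d)³)`. [folklore] -/
theorem dphase_three (t d y : ℝ) :
    dphase t d 3 y = 2 * (t / (2 * π)) * ((y ^ 3)⁻¹ - ((y + d) ^ 3)⁻¹) := by
  simp only [dphase, phaseD_negt_three]; ring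

/-- `φ_d''''(y) = -6K(1/y⁴ - 1/(y+d)⁴)`. [folklore] -/
theorem dphase_four (t d y : ℝ) :
    dphase t d 4 y = -(6 * (t / (2 * π))) * ((y ^ 4)⁻¹ - ((y + d) ^ 4)⁻¹) := by
  simp only [dphase, phaseD_negt_four]; ring

/-- `dphase t d (j+1)` is the derivative of `dphase t d j` at every `y > 0` (`d ≥ 0`). [folklore] -/
theorem hasDerivAt_dphase (t : ℝ) {d y : ℝ} (hd : 0 ≤ d) (hy : 0 < y) (j : ℕ) :
    HasDerivAt (dphase t d j) (dphase t d (j + 1) y) y := by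
  have h1 : HasDerivAt (phaseD (-t) j) (phaseD (-t) (j + 1) y) y :=
    phaseD_derivFamily (-t) (a := y) (b := y) hy (j + 1) j (Nat.lt_succ_self j) y ⟨le_rfl, le_rfl⟩
  have hyd : 0 < y + d := by linarith
  have h2 : HasDerivAt (phaseD (-t) j) (phaseD (-t) (j + 1) (y + d)) (y + d) :=
    phaseD_derivFamily (-t) (a := y + d) (b := y + d) hyd (j + 1) j (Nat.lt_succ_self j) (y + d)
      ⟨le_rfl, le_rfl⟩
  have h3 : HasDerivAt (fun x => phaseD (-t) j (x + d)) (phaseD (-t) (j + 1) (y + d)) y :=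
    HasDerivAt.comp_add_const y d h2
  exact h1.sub h3

/-- `dphase t d` is a derivative family of every order on `[a, b]`, `0 < a`. [folklore] -/
theorem dphase_derivFamily (t : ℝ) {d a b : ℝ} (hd : 0 ≤ d) (ha : 0 < a) (k : ℕ) :
    DerivFamily (dphase t d) a b k :=
  fun j _ _ hy => hasDerivAt_dphase t hd (ha.trans_le hy.1) j

/-- Continuity of `dphase t d j` on `(0, ∞)`. [folklore] -/
theorem continuousAt_dphase (t : ℝ) {d y : ℝ} (hd : 0 ≤ d) (hy : 0 < y) (j : ℕ) :
    ContinuousAt (dphase t d j) y :=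
  (hasDerivAt_dphase t hd hy j).continuousAt

/-! ### Closed forms in `p = 1/y`, `q = 1/(y + d)` and size bounds on the box `M/4 ≤ y`, `y + d ≤ 4M` -/

/-- `1/y - 1/(y+d) = d/(y(y+d))`. [folklore] -/
theorem inv_sub_inv_add_eq {y d : ℝ} (hy : 0 < y) (hyd : 0 < y + d) :
    y⁻¹ - (y + d)⁻¹ = d / (y * (y + d)) := by
  field_simp
  ring

/-- Bounds for `p = 1/y`, `q = 1/(y+d)` and `p - q` on the box. [folklore] -/
theorem pq_bounds {M y d : ℝ} (hM : 0 < M) (hy : M / 4 ≤ y) (hyd : y + d ≤ 4 * M) (hd : 0 ≤ d) :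
    (4 * M)⁻¹ ≤ y⁻¹ ∧ y⁻¹ ≤ 4 / M ∧ (4 * M)⁻¹ ≤ (y + d)⁻¹ ∧ (y + d)⁻¹ ≤ 4 / M
    ∧ d / (16 * M ^ 2) ≤ y⁻¹ - (y + d)⁻¹ ∧ y⁻¹ - (y + d)⁻¹ ≤ 16 * d / M ^ 2 := by
  have hy0 : 0 < y := by linarith
  have hyd0 : 0 < y + d := by linarith
  have hy4 : y ≤ 4 * M := by linarith
  have hyd4 : M / 4 ≤ y + d := by linarith
  refine ⟨?_, ?_, ?_, ?_, ?_, ?_⟩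
  · exact inv_anti₀ hy0 hy4
  · rw [div_eq_mul_inv, show (4 : ℝ) * M⁻¹ = (M / 4)⁻¹ by rw [inv_div]; ring]
    exact inv_anti₀ (by positivity) hy
  · exact inv_anti₀ hyd0 hyd
  · rw [div_eq_mul_inv, show (4 : ℝ) * M⁻¹ = (M / 4)⁻¹ by rw [inv_div]; ring]
    exact inv_anti₀ (by positivity) hyd4
  · rw [inv_sub_inv_add_eq hy0 hyd0]
    rw [div_le_div_iff₀ (by positivity) (by positivity)]
    have : y * (y + d) ≤ 4 * M * (4 * M) := mul_le_mul hy4 hyd (by positivity) (by positivity)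
    nlinarith
  · rw [inv_sub_inv_add_eq hy0 hyd0]
    rw [div_le_div_iff₀ (by positivity) (by positivity)]
    have : M / 4 * (M / 4) ≤ y * (y + d) := mul_le_mul hy hyd4 (by positivity) (by positivity)
    nlinarith

/-- **Size of `-φ_d''` on the box**: `Kd/(32M³) ≤ -φ_d''(y) ≤ 128Kd/M³` for `M/4 ≤ y`,
`y + d ≤ 4M`, `d ≥ 0`, `K = t/2π > 0`. [folklore] -/
theorem neg_dphase_two_bounds {t M y d : ℝ} (ht : 0 < t) (hM : 0 < M) (hy : M / 4 ≤ y)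
    (hyd : y + d ≤ 4 * M) (hd : 0 ≤ d) :
    t / (2 * π) * d / (32 * M ^ 3) ≤ -dphase t d 2 y
    ∧ -dphase t d 2 y ≤ 128 * (t / (2 * π) * d / M ^ 3) := by
  have hK : 0 < t / (2 * π) := by positivity
  have hy0 : 0 < y := by linarith
  have hyd0 : 0 < y + d := by linarith
  obtain ⟨hp1, hp2, hq1, hq2, hpq1, hpq2⟩ := pq_bounds hM hy hyd hd
  set p : ℝ := y⁻¹ with hp
  set q : ℝ := (y + d)⁻¹ with hq
  have hform : -dphase t d 2 y = t / (2 * π) * ((p - q) * (p + q)) := by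
    rw [dphase_two, hp, hq, ← inv_pow, ← inv_pow]; ring
  rw [hform]
  have hpq0 : 0 ≤ p - q := le_trans (by positivity) hpq1
  constructor
  · have h1 : d / (16 * M ^ 2) * (2 * (4 * M)⁻¹) ≤ (p - q) * (p + q) :=
      mul_le_mul hpq1 (by linarith) (by positivity) hpq0
    calc t / (2 * π) * d / (32 * M ^ 3) = t / (2 * π) * (d / (16 * M ^ 2) * (2 * (4 * M)⁻¹)) := by
          field_simp; ring
      _ ≤ t / (2 * π) * ((p - q) * (p + q)) := mul_le_mul_of_nonneg_left h1 hK.le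
  · have h1 : (p - q) * (p + q) ≤ 16 * d / M ^ 2 * (4 / M + 4 / M) :=
      mul_le_mul hpq2 (by linarith) (by positivity) (by positivity)
    calc t / (2 * π) * ((p - q) * (p + q)) ≤ t / (2 * π) * (16 * d / M ^ 2 * (4 / M + 4 / M)) :=
          mul_le_mul_of_nonneg_left h1 hK.le
      _ = 128 * (t / (2 * π) * d / M ^ 3) := by field_simp; ring

/-- **Size of `φ_d'''` on the box**: `0 < φ_d'''(y) ≤ 1536Kd/M⁴` (`d > 0`). [folklore] -/
theorem dphase_three_bounds {t M y d : ℝ} (ht : 0 < t) (hM : 0 < M) (hy : M / 4 ≤ y)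
    (hyd : y + d ≤ 4 * M) (hd : 0 < d) :
    0 < dphase t d 3 y ∧ dphase t d 3 y ≤ 1536 * (t / (2 * π) * d / M ^ 4) := by
  have hK : 0 < t / (2 * π) := by positivity
  have hy0 : 0 < y := by linarith
  have hyd0 : 0 < y + d := by linarith
  obtain ⟨hp1, hp2, hq1, hq2, hpq1, hpq2⟩ := pq_bounds hM hy hyd hd.le
  set p : ℝ := y⁻¹ with hp
  set q : ℝ := (y + d)⁻¹ with hq
  have hform : dphase t d 3 y = 2 * (t / (2 * π)) * ((p - q) * (p ^ 2 + p * q + q ^ 2)) := by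
    rw [dphase_three, hp, hq, ← inv_pow, ← inv_pow]; ring
  rw [hform]
  have hp0 : 0 < p := by positivity
  have hq0 : 0 < q := by positivity
  have hpq0 : 0 < p - q := lt_of_lt_of_le (by positivity) hpq1
  constructor
  · positivity
  · have h2 : p ^ 2 + p * q + q ^ 2 ≤ 3 * (4 / M) ^ 2 := by nlinarith
    have h1 : (p - q) * (p ^ 2 + p * q + q ^ 2) ≤ 16 * d / M ^ 2 * (3 * (4 / M) ^ 2) :=
      mul_le_mul hpq2 h2 (by positivity) (by positivity)
    calc 2 * (t / (2 * π)) * ((p - q) * (p ^ 2 + p * q + q ^ 2))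
        ≤ 2 * (t / (2 * π)) * (16 * d / M ^ 2 * (3 * (4 / M) ^ 2)) :=
          mul_le_mul_of_nonneg_left h1 (by positivity)
      _ = 1536 * (t / (2 * π) * d / M ^ 4) := by field_simp; ring

/-- The fourth derivative of the dual phase in closed form: with `p = 1/y`, `q = 1/(y+d)`,
`(φ''''φ'' - 3φ'''²)/φ''⁵ = 6P/(K³(p-q)³(p+q)⁵)`, `P = p⁴ + 2p³q + 4p²q² + 2pq³ + q⁴`.
[cite: GrahamKolesnik1991, eq. (3.5.3)] -/
theorem dual_fourth_eq {t d y : ℝ} (ht : 0 < t) (hy : 0 < y) (hd : 0 < d) :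
    (dphase t d 4 y * dphase t d 2 y - 3 * dphase t d 3 y ^ 2) / dphase t d 2 y ^ 5
      = 6 * (y⁻¹ ^ 4 + 2 * y⁻¹ ^ 3 * (y + d)⁻¹ + 4 * y⁻¹ ^ 2 * (y + d)⁻¹ ^ 2
          + 2 * y⁻¹ * (y + d)⁻¹ ^ 3 + (y + d)⁻¹ ^ 4)
        / ((t / (2 * π)) ^ 3 * (y⁻¹ - (y + d)⁻¹) ^ 3 * (y⁻¹ + (y + d)⁻¹) ^ 5) := by
  have hK : 0 < t / (2 * π) := by positivity
  have hyd : 0 < y + d := by linarith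
  set K : ℝ := t / (2 * π) with hKdef
  set p : ℝ := y⁻¹ with hp
  set q : ℝ := (y + d)⁻¹ with hq
  have hq0 : 0 < q := by positivity
  have hpq : 0 < p - q := by
    rw [hp, hq, inv_sub_inv_add_eq hy hyd]; positivity
  have hpq' : 0 < p + q := by positivity
  have h2 : dphase t d 2 y = -K * ((p - q) * (p + q)) := by
    rw [dphase_two, hp, hq, ← inv_pow, ← inv_pow]; ring
  have h3 : dphase t d 3 y = 2 * K * ((p - q) * (p ^ 2 + p * q + q ^ 2)) := by
    rw [dphase_three, hp, hq, ← inv_pow, ← inv_pow]; ring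
  have h4 : dphase t d 4 y = -(6 * K) * ((p - q) * (p + q) * (p ^ 2 + q ^ 2)) := by
    rw [dphase_four, hp, hq, ← inv_pow, ← inv_pow]; ring
  rw [h2, h3, h4]
  have hne1 : (p - q) ≠ 0 := hpq.ne'
  have hne2 : (p + q) ≠ 0 := hpq'.ne'
  have hne3 : K ≠ 0 := hK.ne'
  field_simp
  ring

/-- **Size of the fourth derivative of the dual phase on the box**:
`(15/2³³) M⁷/(Kd)³ ≤ (φ''''φ'' - 3φ'''²)/φ''⁵ ≤ (15·2²⁷) M⁷/(Kd)³`. [folklore] -/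
theorem dual_fourth_bounds {t M y d : ℝ} (ht : 0 < t) (hM : 0 < M) (hy : M / 4 ≤ y)
    (hyd : y + d ≤ 4 * M) (hd : 0 < d) :
    15 / 2 ^ 33 * (M ^ 7 / ((t / (2 * π)) * d) ^ 3)
        ≤ (dphase t d 4 y * dphase t d 2 y - 3 * dphase t d 3 y ^ 2) / dphase t d 2 y ^ 5
    ∧ (dphase t d 4 y * dphase t d 2 y - 3 * dphase t d 3 y ^ 2) / dphase t d 2 y ^ 5
        ≤ 15 * 2 ^ 27 * (M ^ 7 / ((t / (2 * π)) * d) ^ 3) := by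
  have hK : 0 < t / (2 * π) := by positivity
  have hy0 : 0 < y := by linarith
  have hyd0 : 0 < y + d := by linarith
  rw [dual_fourth_eq ht hy0 hd]
  obtain ⟨hp1, hp2, hq1, hq2, hpq1, hpq2⟩ := pq_bounds hM hy hyd hd.le
  set K : ℝ := t / (2 * π) with hKdef
  set p : ℝ := y⁻¹ with hp
  set q : ℝ := (y + d)⁻¹ with hq
  have hp0 : 0 < p := by positivity
  have hq0 : 0 < q := by positivity
  have hpq0 : 0 < p - q := lt_of_lt_of_le (by positivity) hpq1
  set P : ℝ := p ^ 4 + 2 * p ^ 3 * q + 4 * p ^ 2 * q ^ 2 + 2 * p * q ^ 3 + q ^ 4 with hP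
  -- bounds for `P`, `(p - q)³`, `(p + q)⁵`
  have hm : (4 * M)⁻¹ ≤ min p q := le_min hp1 hq1
  have hmin0 : 0 < (4 * M)⁻¹ := by positivity
  have hPlo : 10 * ((4 * M)⁻¹) ^ 4 ≤ P := by
    have h1 : ((4 * M)⁻¹) ^ 4 ≤ p ^ 4 := pow_le_pow_left₀ hmin0.le hp1 4
    have h2 : ((4 * M)⁻¹) ^ 4 ≤ q ^ 4 := pow_le_pow_left₀ hmin0.le hq1 4
    have h3 : ((4 * M)⁻¹) ^ 4 ≤ p ^ 3 * q := by
      calc ((4 * M)⁻¹) ^ 4 = ((4 * M)⁻¹) ^ 3 * (4 * M)⁻¹ := by ring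
        _ ≤ p ^ 3 * q := mul_le_mul (pow_le_pow_left₀ hmin0.le hp1 3) hq1 hmin0.le (by positivity)
    have h4 : ((4 * M)⁻¹) ^ 4 ≤ p ^ 2 * q ^ 2 := by
      calc ((4 * M)⁻¹) ^ 4 = ((4 * M)⁻¹) ^ 2 * ((4 * M)⁻¹) ^ 2 := by ring
        _ ≤ p ^ 2 * q ^ 2 := mul_le_mul (pow_le_pow_left₀ hmin0.le hp1 2)
            (pow_le_pow_left₀ hmin0.le hq1 2) (by positivity) (by positivity)
    have h5 : ((4 * M)⁻¹) ^ 4 ≤ p * q ^ 3 := by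
      calc ((4 * M)⁻¹) ^ 4 = (4 * M)⁻¹ * ((4 * M)⁻¹) ^ 3 := by ring
        _ ≤ p * q ^ 3 := mul_le_mul hp1 (pow_le_pow_left₀ hmin0.le hq1 3) (by positivity) hp0.le
    rw [hP]; nlinarith
  have hPhi : P ≤ 10 * (4 / M) ^ 4 := by
    have h40 : 0 ≤ 4 / M := by positivity
    have h1 : p ^ 4 ≤ (4 / M) ^ 4 := pow_le_pow_left₀ hp0.le hp2 4
    have h2 : q ^ 4 ≤ (4 / M) ^ 4 := pow_le_pow_left₀ hq0.le hq2 4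
    have h3 : p ^ 3 * q ≤ (4 / M) ^ 4 := by
      calc p ^ 3 * q ≤ (4 / M) ^ 3 * (4 / M) :=
            mul_le_mul (pow_le_pow_left₀ hp0.le hp2 3) hq2 hq0.le (by positivity)
        _ = (4 / M) ^ 4 := by ring
    have h4 : p ^ 2 * q ^ 2 ≤ (4 / M) ^ 4 := by
      calc p ^ 2 * q ^ 2 ≤ (4 / M) ^ 2 * (4 / M) ^ 2 :=
            mul_le_mul (pow_le_pow_left₀ hp0.le hp2 2) (pow_le_pow_left₀ hq0.le hq2 2)
              (by positivity) (by positivity)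
        _ = (4 / M) ^ 4 := by ring
    have h5 : p * q ^ 3 ≤ (4 / M) ^ 4 := by
      calc p * q ^ 3 ≤ (4 / M) * (4 / M) ^ 3 :=
            mul_le_mul hp2 (pow_le_pow_left₀ hq0.le hq2 3) (by positivity) h40
        _ = (4 / M) ^ 4 := by ring
    rw [hP]; nlinarith
  have hA3lo : (d / (16 * M ^ 2)) ^ 3 ≤ (p - q) ^ 3 := pow_le_pow_left₀ (by positivity) hpq1 3
  have hA3hi : (p - q) ^ 3 ≤ (16 * d / M ^ 2) ^ 3 := pow_le_pow_left₀ hpq0.le hpq2 3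
  have hB5lo : (2 * (4 * M)⁻¹) ^ 5 ≤ (p + q) ^ 5 :=
    pow_le_pow_left₀ (by positivity) (by linarith) 5
  have hB5hi : (p + q) ^ 5 ≤ (4 / M + 4 / M) ^ 5 :=
    pow_le_pow_left₀ (by positivity) (by linarith) 5
  have hden0 : 0 < K ^ 3 * (p - q) ^ 3 * (p + q) ^ 5 := by positivity
  constructor
  · -- lower bound
    rw [mul_div_assoc', div_le_div_iff₀ (by positivity) hden0]
    calc 15 / 2 ^ 33 * M ^ 7 * (K ^ 3 * (p - q) ^ 3 * (p + q) ^ 5)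
        ≤ 15 / 2 ^ 33 * M ^ 7 * (K ^ 3 * (16 * d / M ^ 2) ^ 3 * (4 / M + 4 / M) ^ 5) := by
          gcongr
      _ = 6 * (10 * ((4 * M)⁻¹) ^ 4) * (K * d) ^ 3 := by field_simp; ring
      _ ≤ 6 * P * (K * d) ^ 3 := by gcongr
  · -- upper bound
    rw [mul_div_assoc', div_le_div_iff₀ hden0 (by positivity)]
    calc 6 * P * (K * d) ^ 3 ≤ 6 * (10 * (4 / M) ^ 4) * (K * d) ^ 3 := by gcongr
      _ = 15 * 2 ^ 27 * M ^ 7 * (K ^ 3 * (d / (16 * M ^ 2)) ^ 3 * (2 * (4 * M)⁻¹) ^ 5) := by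
          field_simp; ring
      _ ≤ 15 * 2 ^ 27 * M ^ 7 * (K ^ 3 * (p - q) ^ 3 * (p + q) ^ 5) := by gcongr

/-! ### The stationary point `x_ν` -/

/-- The stationary point of `φ_d(x) - νx`: `x_ν = ((d² + 4Kd/ν)^{1/2} - d)/2`, the positive root
of `x(x + d) = Kd/ν` (`K = t/2π`). [folklore] -/
def xsLog (t d ν : ℝ) : ℝ := (Real.sqrt (d ^ 2 + 4 * (t / (2 * π)) * d / ν) - d) / 2

/-- `x_ν > 0` for `t, d, ν > 0`. [folklore] -/
theorem xsLog_pos {t d ν : ℝ} (ht : 0 < t) (hd : 0 < d) (hν : 0 < ν) : 0 < xsLog t d ν := by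
  unfold xsLog
  have hK : 0 < t / (2 * π) := by positivity
  have h1 : d < Real.sqrt (d ^ 2 + 4 * (t / (2 * π)) * d / ν) := by
    rw [Real.lt_sqrt hd.le]
    have : 0 < 4 * (t / (2 * π)) * d / ν := by positivity
    linarith
  linarith

/-- `x_ν (x_ν + d) = Kd/ν`. [folklore] -/
theorem xsLog_mul {t d ν : ℝ} (ht : 0 < t) (hd : 0 < d) (hν : 0 < ν) :
    xsLog t d ν * (xsLog t d ν + d) = (t / (2 * π)) * d / ν := by
  unfold xsLog
  have hK : 0 < t / (2 * π) := by positivity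
  have harg : 0 ≤ d ^ 2 + 4 * (t / (2 * π)) * d / ν := by positivity
  have hsq := Real.sq_sqrt harg
  set R : ℝ := Real.sqrt (d ^ 2 + 4 * (t / (2 * π)) * d / ν) with hR
  rw [show (R - d) / 2 * ((R - d) / 2 + d) = (R ^ 2 - d ^ 2) / 4 by ring, hsq]
  ring

/-- **`φ_d'(x_ν) = ν`.** [folklore] -/
theorem dphase_one_xsLog {t d ν : ℝ} (ht : 0 < t) (hd : 0 < d) (hν : 0 < ν) :
    dphase t d 1 (xsLog t d ν) = ν := by
  have hx := xsLog_pos ht hd hν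
  have hxd : 0 < xsLog t d ν + d := by linarith
  rw [dphase_one, inv_sub_inv_add_eq hx hxd, xsLog_mul ht hd hν]
  have hK : 0 < t / (2 * π) := by positivity
  field_simp

/-- `x_ν` is continuous at every `ν > 0`. [folklore] -/
theorem continuousAt_xsLog {t d ν : ℝ} (hν : 0 < ν) : ContinuousAt (xsLog t d) ν := by
  unfold xsLog
  have h : ContinuousAt (fun ν : ℝ => d ^ 2 + 4 * (t / (2 * π)) * d / ν) ν :=
    continuousAt_const.add ((continuousAt_const).div continuousAt_id hν.ne')
  exact (h.sqrt.sub continuousAt_const).div_const 2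

/-- `φ_d'` is strictly decreasing on `(0, ∞)`: `φ_d'(y) = Kd/(y(y+d))`. [folklore] -/
theorem dphase_one_strictAnti {t d y₁ y₂ : ℝ} (ht : 0 < t) (hd : 0 < d) (hy₁ : 0 < y₁)
    (h12 : y₁ < y₂) : dphase t d 1 y₂ < dphase t d 1 y₁ := by
  have hy₂ : 0 < y₂ := hy₁.trans h12
  have hK : 0 < t / (2 * π) := by positivity
  rw [dphase_one, dphase_one, inv_sub_inv_add_eq hy₁ (by linarith), inv_sub_inv_add_eq hy₂ (by linarith)]
  apply mul_lt_mul_of_pos_left _ hK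
  apply div_lt_div_of_pos_left hd (by positivity)
  nlinarith

/-- **Localisation of `x_ν`**: if `0 < a ≤ b` and `φ_d'(b) < ν ≤ φ_d'(a)` then `x_ν ∈ [a, b]`.
[folklore] -/
theorem xsLog_mem_Icc {t d a b ν : ℝ} (ht : 0 < t) (hd : 0 < d) (ha : 0 < a)
    (hνb : dphase t d 1 b < ν) (hνa : ν ≤ dphase t d 1 a) (hab : a ≤ b) :
    xsLog t d ν ∈ Icc a b := by
  have hνpos : 0 < ν := by
    have hb : 0 < b := ha.trans_le hab
    have : 0 < dphase t d 1 b := by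
      rw [dphase_one, inv_sub_inv_add_eq hb (by linarith)]
      have hK : 0 < t / (2 * π) := by positivity
      positivity
    linarith
  have hx := xsLog_pos ht hd hνpos
  have hfx := dphase_one_xsLog ht hd hνpos
  constructor
  · by_contra h
    push Not at h
    have := dphase_one_strictAnti ht hd hx h
    linarith
  · by_contra h
    push Not at h
    have := dphase_one_strictAnti ht hd (ha.trans_le hab) h
    linarith

/-- **`x_ν' = 1/φ_d''(x_ν)`** (inverse function rule). [folklore] -/
theorem hasDerivAt_xsLog {t d ν : ℝ} (ht : 0 < t) (hd : 0 < d) (hν : 0 < ν) :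
    HasDerivAt (xsLog t d) (dphase t d 2 (xsLog t d ν))⁻¹ ν := by
  have hx := xsLog_pos ht hd hν
  refine HasDerivAt.of_local_left_inverse (continuousAt_xsLog hν)
    (hasDerivAt_dphase t hd.le hx 1) ?_ ?_
  · have hxd : xsLog t d ν + d ≤ 4 * (xsLog t d ν + d) := by linarith
    -- `-φ'' > 0`
    have h := dphase_two t d (xsLog t d ν)
    have hK : 0 < t / (2 * π) := by positivity
    have hlt : ((xsLog t d ν + d) ^ 2)⁻¹ < ((xsLog t d ν) ^ 2)⁻¹ := by
      apply inv_strictAnti₀ (by positivity)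
      nlinarith
    rw [h]
    intro h0
    have : (xsLog t d ν ^ 2)⁻¹ - ((xsLog t d ν + d) ^ 2)⁻¹ = 0 := by
      rcases mul_eq_zero.1 h0 with h1 | h1
      · linarith
      · exact h1
    linarith
  · filter_upwards [lt_mem_nhds hν] with μ hμ
    exact dphase_one_xsLog ht hd hμ

/-- `x_ν` is non-increasing in `ν`. [folklore] -/
theorem xsLog_antitone {t d ν₁ ν₂ : ℝ} (ht : 0 < t) (hd : 0 < d) (hν₁ : 0 < ν₁) (h12 : ν₁ ≤ ν₂) :
    xsLog t d ν₂ ≤ xsLog t d ν₁ := by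
  unfold xsLog
  have hK : 0 < t / (2 * π) := by positivity
  have hν₂ : 0 < ν₂ := hν₁.trans_le h12
  have h1 : 4 * (t / (2 * π)) * d / ν₂ ≤ 4 * (t / (2 * π)) * d / ν₁ :=
    div_le_div_of_nonneg_left (by positivity) hν₁ h12
  have h2 : Real.sqrt (d ^ 2 + 4 * (t / (2 * π)) * d / ν₂)
      ≤ Real.sqrt (d ^ 2 + 4 * (t / (2 * π)) * d / ν₁) := Real.sqrt_le_sqrt (by linarith)
  linarith

/-- If `x_ν(x_ν + d) ≤ 15M²` and `d ≤ M/4` then `x_ν + d ≤ 4M`. [folklore] -/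
theorem xsLog_add_le {t d ν M : ℝ} (ht : 0 < t) (hd : 0 < d) (hν : 0 < ν) (hM : 0 < M)
    (hdM : d ≤ M / 4) (hprod : (t / (2 * π)) * d / ν ≤ 15 * M ^ 2) :
    xsLog t d ν + d ≤ 4 * M := by
  have hx := xsLog_pos ht hd hν
  have hmul := xsLog_mul ht hd hν
  by_contra h
  push Not at h
  have h1 : 15 * M / 4 < xsLog t d ν := by linarith
  have : 15 * M / 4 * (4 * M) < xsLog t d ν * (xsLog t d ν + d) :=
    mul_lt_mul'' h1 h (by positivity) (by positivity)
  nlinarith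

/-! ### The dual phase family `ψ^{(j)}`, `j ≤ 4` -/

/-- The derivative family of the dual phase `ψ(ν) = φ_d(x_ν) - νx_ν` up to order `4`:
`E₀ = ψ`, `E₁ = -x_ν`, `E₂ = -1/φ''(x_ν)`, `E₃ = φ'''(x_ν)/φ''(x_ν)³`,
`E₄ = (φ''''φ'' - 3φ'''²)(x_ν)/φ''(x_ν)⁵` (and `0` beyond).
[cite: GrahamKolesnik1991, Lemma 3.9, eq. (3.5.3)] -/
def dualFamily (t d : ℝ) : ℕ → ℝ → ℝ
  | 0 => fun ν => dphase t d 0 (xsLog t d ν) - ν * xsLog t d ν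
  | 1 => fun ν => -xsLog t d ν
  | 2 => fun ν => -(dphase t d 2 (xsLog t d ν))⁻¹
  | 3 => fun ν => dphase t d 3 (xsLog t d ν) / dphase t d 2 (xsLog t d ν) ^ 3
  | 4 => fun ν => (dphase t d 4 (xsLog t d ν) * dphase t d 2 (xsLog t d ν)
      - 3 * dphase t d 3 (xsLog t d ν) ^ 2) / dphase t d 2 (xsLog t d ν) ^ 5
  | _ + 5 => fun _ => 0

/-- `φ_d''(x_ν) ≠ 0` (indeed `< 0`). [folklore] -/
theorem dphase_two_xsLog_neg {t d ν : ℝ} (ht : 0 < t) (hd : 0 < d) (hν : 0 < ν) :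
    dphase t d 2 (xsLog t d ν) < 0 := by
  have hx := xsLog_pos ht hd hν
  have hK : 0 < t / (2 * π) := by positivity
  rw [dphase_two]
  have hlt : ((xsLog t d ν + d) ^ 2)⁻¹ < ((xsLog t d ν) ^ 2)⁻¹ := by
    apply inv_strictAnti₀ (by positivity)
    nlinarith
  have : 0 < (xsLog t d ν ^ 2)⁻¹ - ((xsLog t d ν + d) ^ 2)⁻¹ := by linarith
  nlinarith

/-- **The dual family is a derivative family on `(0, ∞)`**: `E_{j+1} = E_j'` for `j < 4`.
[cite: GrahamKolesnik1991, Lemma 3.9] -/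
theorem hasDerivAt_dualFamily {t d ν : ℝ} (ht : 0 < t) (hd : 0 < d) (hν : 0 < ν) (j : ℕ)
    (hj : j < 4) : HasDerivAt (dualFamily t d j) (dualFamily t d (j + 1) ν) ν := by
  have hx := xsLog_pos ht hd hν
  have hxs := hasDerivAt_xsLog ht hd hν
  have h2ne : dphase t d 2 (xsLog t d ν) ≠ 0 := (dphase_two_xsLog_neg ht hd hν).ne
  interval_cases j
  · -- `ψ' = -x_ν`
    show HasDerivAt (fun ν => dphase t d 0 (xsLog t d ν) - ν * xsLog t d ν) (-xsLog t d ν) ν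
    have h0 := (hasDerivAt_dphase t hd.le hx 0).comp ν hxs
    have h1 : HasDerivAt (fun ν : ℝ => ν * xsLog t d ν)
        (1 * xsLog t d ν + ν * (dphase t d 2 (xsLog t d ν))⁻¹) ν :=
      (hasDerivAt_id' ν).mul hxs
    have h := h0.sub h1
    refine h.congr_deriv ?_
    rw [zero_add, dphase_one_xsLog ht hd hν]
    ring
  · -- `(-x_ν)' = -1/φ''(x_ν)`
    show HasDerivAt (fun ν => -xsLog t d ν) (-(dphase t d 2 (xsLog t d ν))⁻¹) ν
    exact hxs.neg
  · -- `(-1/φ''(x_ν))' = φ'''/φ''³`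
    show HasDerivAt (fun ν => -(dphase t d 2 (xsLog t d ν))⁻¹)
      (dphase t d 3 (xsLog t d ν) / dphase t d 2 (xsLog t d ν) ^ 3) ν
    have hg := (hasDerivAt_dphase t hd.le hx 2).comp ν hxs
    have h := (hg.inv h2ne).neg
    refine h.congr_deriv ?_
    simp only [Function.comp_apply]
    field_simp
  · -- `(φ'''/φ''³)' = (φ''''φ'' - 3φ'''²)/φ''⁵`
    show HasDerivAt (fun ν => dphase t d 3 (xsLog t d ν) / dphase t d 2 (xsLog t d ν) ^ 3)
      ((dphase t d 4 (xsLog t d ν) * dphase t d 2 (xsLog t d ν)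
        - 3 * dphase t d 3 (xsLog t d ν) ^ 2) / dphase t d 2 (xsLog t d ν) ^ 5) ν
    have hnum := (hasDerivAt_dphase t hd.le hx 3).comp ν hxs
    have hg := (hasDerivAt_dphase t hd.le hx 2).comp ν hxs
    have hden := hg.pow 3
    have h := hnum.div hden (pow_ne_zero 3 h2ne)
    refine h.congr_deriv ?_
    simp only [Function.comp_apply, Pi.pow_apply]
    push_cast
    field_simp

/-- The dual family is a `DerivFamily` of order `4` on `[a, b]`, `0 < a`. [folklore] -/
theorem dualFamily_derivFamily {t d a b : ℝ} (ht : 0 < t) (hd : 0 < d) (ha : 0 < a) :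
    DerivFamily (dualFamily t d) a b 4 :=
  fun j hj _ hν => hasDerivAt_dualFamily ht hd (ha.trans_le hν.1) j hj

/-- `E₀ = ψ`: `dualFamily t d 0 ν = φ_d(x_ν) - νx_ν`. [folklore] -/
theorem dualFamily_zero (t d ν : ℝ) :
    dualFamily t d 0 ν = dphase t d 0 (xsLog t d ν) - ν * xsLog t d ν := rfl

/-- `E₄`: `dualFamily t d 4 ν = (φ''''φ'' - 3φ'''²)(x_ν)/φ''(x_ν)⁵`. [folklore] -/
theorem dualFamily_four (t d ν : ℝ) :
    dualFamily t d 4 ν = (dphase t d 4 (xsLog t d ν) * dphase t d 2 (xsLog t d ν)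
      - 3 * dphase t d 3 (xsLog t d ν) ^ 2) / dphase t d 2 (xsLog t d ν) ^ 5 := rfl

/-! ### The weights `|φ''(x_ν)|^{-1/2}` are non-increasing in `ν` -/

/-- `-φ_d''` is non-increasing on `(0, ∞)` (its derivative is `-φ_d''' < 0`). [folklore] -/
theorem neg_dphase_two_antitone {t d y₁ y₂ : ℝ} (ht : 0 < t) (hd : 0 < d) (hy₁ : 0 < y₁)
    (h12 : y₁ ≤ y₂) : -dphase t d 2 y₂ ≤ -dphase t d 2 y₁ := by
  have hanti : AntitoneOn (fun y => -dphase t d 2 y) (Ioi 0) := by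
    refine antitoneOn_of_hasDerivWithinAt_nonpos (convex_Ioi 0) (f' := fun y => -dphase t d 3 y)
      ?_ ?_ ?_
    · intro y hy
      exact ((hasDerivAt_dphase t hd.le hy 2).neg).continuousAt.continuousWithinAt
    · intro y hy
      rw [interior_Ioi] at hy
      exact ((hasDerivAt_dphase t hd.le hy 2).neg).hasDerivWithinAt
    · intro y hy
      rw [interior_Ioi] at hy
      have hK : 0 < t / (2 * π) := by positivity
      have hy0 : (0 : ℝ) < y := hy
      rw [dphase_three]
      have hlt : ((y + d) ^ 3)⁻¹ < (y ^ 3)⁻¹ := by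
        apply inv_strictAnti₀ (by positivity)
        have h1 : y < y + d := by linarith
        exact pow_lt_pow_left₀ h1 hy0.le (by norm_num)
      have : 0 < (y ^ 3)⁻¹ - ((y + d) ^ 3)⁻¹ := by linarith
      nlinarith
  exact hanti hy₁ (hy₁.trans_le h12) h12

/-- **The `B`-process weights `w(ν) = |φ_d''(x_ν)|^{-1/2}` are non-increasing in `ν > 0`.**
[folklore] -/
theorem weight_antitone {t d ν₁ ν₂ : ℝ} (ht : 0 < t) (hd : 0 < d) (hν₁ : 0 < ν₁) (h12 : ν₁ ≤ ν₂) :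
    (Real.sqrt (-dphase t d 2 (xsLog t d ν₂)))⁻¹ ≤ (Real.sqrt (-dphase t d 2 (xsLog t d ν₁)))⁻¹ := by
  have hν₂ : 0 < ν₂ := hν₁.trans_le h12
  have hx₂ := xsLog_pos ht hd hν₂
  have hxx : xsLog t d ν₂ ≤ xsLog t d ν₁ := xsLog_antitone ht hd hν₁ h12
  have hmono : -dphase t d 2 (xsLog t d ν₁) ≤ -dphase t d 2 (xsLog t d ν₂) :=
    neg_dphase_two_antitone ht hd hx₂ hxx
  have hpos₁ : 0 < -dphase t d 2 (xsLog t d ν₁) := by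
    have := dphase_two_xsLog_neg ht hd hν₁; linarith
  exact inv_anti₀ (Real.sqrt_pos.2 hpos₁) (Real.sqrt_le_sqrt hmono)

end VdC
end Literature.NumberTheory.LFunctions

end
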